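import Summits.CriticalPhenomena.PercolationContinuityZ3.Theorems.PercNearOneGluingNoHeavyLowerTailCoinReduction
import HarnessLib

/-!
# `NoHeavyLowerTail` (stmt-CriticalPhenomena-4575) — the coin reduction in the SHAPE OF THE REGISTERED STUB
# `stub_patternLightest`

Support file (prover `prim-hp-8`, PL programme; `--supports stmt-CriticalPhenomena-4575`).  No definitions, no named facts,
no sorries.

The registered stub `stub_patternLightest` (hypothesis `hPL` of `PatternLightest.cumulativeIsolation_of_patternLightest`) asks, for
every weighted graph, relay set `A`, observer `o ∉ A` and level `j`, for a selection `sel` (`sel B ∈ B` for `∅ ≠ B ⊆ A`) with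
`μ(1 ≤ N ≤ j) ≤ Σ_{∅ ≠ B ⊆ A} μ(π⁰(o) = B) · μ(|π(sel B)| ≤ j)`, `π⁰(o) = A.filter (fun b => o ↔ b inside (↑A)ᶜ ∪ {b})`.

(Bookkeeping `exists_compatible_ranking`, `sum_sel_eq_sum_patterns`: `…RankedSelection.lean`.)
* `patternLightest_stub_of_coinfree` — THE COIN REDUCTION IN STUB SHAPE: the stub's inequality for `(w, A, o, j)` (with the
  `H`-argmax selection) follows from the selection-form bound for the observer with all its relay pairs switched off.
* `stub_patternLightest_relayNeighboured` — the stub's statement, verbatim, restricted to observers all of whose positive-weight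
  non-loop pairs go to relays (for these the coin-free observer is isolated).  This is the relay-neighboured case of
  `stub_patternLightest` in the tree's own shape (gen 1 proved the first-open-port form `PatternLightestStar.patternLightest_firstPort`).

Memo PROOF-COIN-REDUCTION.md on the item.
-/

noncomputable section

namespace Summit.CriticalPhenomena.PercolationContinuityZ3.Theorems

namespace CoinReduction

open MeasureTheory Set Literature.Probability.LatticeModels Literature.Probability.Percolation
open scoped Classical BigOperators

variable {n : ℕ}

/-- **The coin reduction in the shape of `stub_patternLightest`.**  `o ∉ A`.  If, for some ranking `r` injective on `A` and
compatible with lightness in `H`, the selection-form pattern-lightest bound holds for the observer with all its relay pairs switched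
off, then the stub's inequality holds at `(v, A, o, j)`: there is a selection `sel` with `sel B ∈ B` (`∅ ≠ B ⊆ A`) and
`μ(1 ≤ N ≤ j) ≤ Σ_{∅≠B⊆A} μ(π⁰ = B)·μ(R_{sel B})`. [folklore — `patternLightest_of_coinfree` + `sum_sel_eq_sum_patterns`] -/
theorem patternLightest_stub_of_coinfree (v : Sym2 (Fin n) → unitInterval) (A : Finset (Fin n)) (o : Fin n) (j : ℕ)
    (hoA : o ∉ A) (r : Fin n → ℕ) (hr : Set.InjOn r ↑A)
    (hcompat : ∀ b ∈ A, ∀ b' ∈ A, r b < r b' →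
      (prodBernoulli fun e : Sym2 (Fin n) => if e ∈ {e : Sym2 (Fin n) | o ∉ e} then v e else 0).real
          {ω : BondConfig (Fin n) | (A.filter fun z => ω ∈ openConn b' z).card ≤ j} ≤
        (prodBernoulli fun e : Sym2 (Fin n) => if e ∈ {e : Sym2 (Fin n) | o ∉ e} then v e else 0).real
          {ω : BondConfig (Fin n) | (A.filter fun z => ω ∈ openConn b z).card ≤ j})
    (hcf : (prodBernoulli fun e : Sym2 (Fin n) => if ∃ c ∈ A, e = s(o, c) then 0 else v e).real
          {ω : BondConfig (Fin n) | 1 ≤ (A.filter fun z => ω ∈ openConn o z).card ∧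
            (A.filter fun z => ω ∈ openConn o z).card ≤ j} ≤
        ∑ b ∈ A, (prodBernoulli fun e : Sym2 (Fin n) => if ∃ c ∈ A, e = s(o, c) then 0 else v e).real
            {ω : BondConfig (Fin n) |
              b ∈ (A.filter fun b' => ω ∈ openConnIn ((↑A : Set (Fin n))ᶜ ∪ {b'}) o b') ∧
              ∀ b' ∈ A, r b' < r b → b' ∉ (A.filter fun b'' => ω ∈ openConnIn ((↑A : Set (Fin n))ᶜ ∪ {b''}) o b'')} *
          (prodBernoulli fun e : Sym2 (Fin n) => if ∃ c ∈ A, e = s(o, c) then 0 else v e).real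
            {ω : BondConfig (Fin n) | (A.filter fun z => ω ∈ openConn b z).card ≤ j}) :
    ∃ sel : Finset (Fin n) → Fin n, (∀ B ∈ A.powerset.erase ∅, sel B ∈ B) ∧
      (prodBernoulli v).real {ω : BondConfig (Fin n) |
          1 ≤ (A.filter fun x => ω ∈ openConn o x).card ∧ (A.filter fun x => ω ∈ openConn o x).card ≤ j} ≤
        ∑ B ∈ A.powerset.erase ∅,
          (prodBernoulli v).real {ω : BondConfig (Fin n) |
              (A.filter fun b => ω ∈ openConnIn ((↑A : Set (Fin n))ᶜ ∪ {b}) o b) = B} *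
            (prodBernoulli v).real {ω : BondConfig (Fin n) | (A.filter fun x => ω ∈ openConn (sel B) x).card ≤ j} := by
  -- the r-argmin selection
  have hex : ∀ B : Finset (Fin n), B.Nonempty → ∃ b ∈ B, ∀ b' ∈ B, r b ≤ r b' :=
    fun B hB => Finset.exists_min_image B r hB
  set sel : Finset (Fin n) → Fin n := fun B => if h : B.Nonempty then Classical.choose (hex B h) else o with hseldef
  have hsel : ∀ B : Finset (Fin n), B.Nonempty → sel B ∈ B ∧ ∀ b ∈ B, r (sel B) ≤ r b := by
    intro B hB
    have h := Classical.choose_spec (hex B hB)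
    simp only [hseldef, dif_pos hB]
    exact ⟨h.1, h.2⟩
  refine ⟨sel, fun B hB => (hsel B (Finset.nonempty_iff_ne_empty.2 (Finset.ne_of_mem_erase hB))).1, ?_⟩
  have key := sum_sel_eq_sum_patterns (prodBernoulli v) A o r hr sel hsel
    (fun b => (prodBernoulli v).real {ω : BondConfig (Fin n) | (A.filter fun x => ω ∈ openConn b x).card ≤ j})
  rw [← key]
  exact patternLightest_of_coinfree v A j o r hr hoA hcompat hcf

/-- **`stub_patternLightest` for relay-neighboured observers** (the registered stub's statement verbatim, restricted to observers
whose positive-weight non-loop pairs all go to relays): for such `(w, A, o, j)` with `o ∉ A` there is a selection `sel`,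
`sel B ∈ B` for `∅ ≠ B ⊆ A`, with
`μ(1 ≤ N ≤ j) ≤ Σ_{∅≠B⊆A} μ(π⁰(o) = B)·μ(|π(sel B)| ≤ j)`.
Proof: rank the relays by lightness in `H`; the coin-free observer is isolated, so its bound is trivial; then
`patternLightest_stub_of_coinfree`. [folklore — via the coin reduction (BHK 1.5)] -/
theorem stub_patternLightest_relayNeighboured :
    ∀ (n : ℕ) (w : Sym2 (Fin n) → unitInterval) (A : Finset (Fin n)) (o : Fin n) (j : ℕ), o ∉ A →
      (∀ y : Fin n, y ≠ o → y ∉ A → w s(o, y) = 0) →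
      ∃ sel : Finset (Fin n) → Fin n, (∀ B ∈ A.powerset.erase ∅, sel B ∈ B) ∧
        (Literature.Probability.LatticeModels.prodBernoulli w).real
            {ω : Literature.Probability.Percolation.BondConfig (Fin n) |
              1 ≤ (A.filter fun x => ω ∈ Literature.Probability.Percolation.openConn o x).card ∧
                (A.filter fun x => ω ∈ Literature.Probability.Percolation.openConn o x).card ≤ j} ≤
          ∑ B ∈ A.powerset.erase ∅,
            (Literature.Probability.LatticeModels.prodBernoulli w).real
                {ω : Literature.Probability.Percolation.BondConfig (Fin n) |
                  (A.filter fun b => ω ∈ Literature.Probability.Percolation.openConnIn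
                      ((↑A : Set (Fin n))ᶜ ∪ {b}) o b) = B} *
              (Literature.Probability.LatticeModels.prodBernoulli w).real
                {ω : Literature.Probability.Percolation.BondConfig (Fin n) |
                  (A.filter fun x => ω ∈ Literature.Probability.Percolation.openConn (sel B) x).card ≤ j} := by
  intro n w A o j hoA hobs
  -- an H-compatible ranking
  obtain ⟨r, hr, hcompat⟩ := exists_compatible_ranking
    (fun b => (prodBernoulli fun e : Sym2 (Fin n) => if e ∈ {e : Sym2 (Fin n) | o ∉ e} then w e else 0).real
      {ω : BondConfig (Fin n) | (A.filter fun z => ω ∈ openConn b z).card ≤ j}) A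
  apply patternLightest_stub_of_coinfree w A o j hoA r hr hcompat
  -- the coin-free observer is isolated: its small-block probability vanishes
  set vA : Sym2 (Fin n) → unitInterval := fun e => if ∃ c ∈ A, e = s(o, c) then 0 else w e with hvA
  have hzero : ∀ y : Fin n, y ≠ o → (vA s(o, y) : ℝ) = 0 := by
    intro y hyo
    simp only [hvA]
    by_cases hyA : y ∈ A
    · rw [if_pos ⟨y, hyA, rfl⟩]; rfl
    · have hne : ¬ ∃ c ∈ A, s(o, y) = s(o, c) := by
        rintro ⟨c, hcA, h⟩
        have : y = c := by
          rcases Sym2.eq_iff.1 h with ⟨_, h2⟩ | ⟨h1, h2⟩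
          · exact h2
          · exact h2.trans h1
        exact hyA (this ▸ hcA)
      rw [if_neg hne, hobs y hyo hyA]; rfl
  have hL : (prodBernoulli vA).real {ω : BondConfig (Fin n) | 1 ≤ (A.filter fun z => ω ∈ openConn o z).card ∧
      (A.filter fun z => ω ∈ openConn o z).card ≤ j} = 0 :=
    MergeStability.real_L_eq_zero_of_isolated vA A o j hoA hzero
  rw [hL]
  exact Finset.sum_nonneg fun b _ => mul_nonneg measureReal_nonneg measureReal_nonneg

end CoinReduction

end Summit.CriticalPhenomena.PercolationContinuityZ3.Theorems

end
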